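import Mathlib.Analysis.Calculus.MeanValue
import Mathlib.Analysis.SpecialFunctions.Pow.Deriv
import Mathlib.Analysis.SpecialFunctions.Pow.Asymptotics
import HarnessLib

/-!
# Finite range of the superlinear lower bound `E' ≥ c ρ^{−α} E^β` (`β > 1`, `α < 1`)

Analysis/ODE proof file (theorems only). The LOWER-bound mirror of `SuperlinearLocalBound` /
`SuperlinearPowerLawLocalBound` (which bound solutions of `y' ≤ C y^p` from above up to the blow-up
horizon): a positive function obeying the separable superlinear law `E'(ρ) ≥ c ρ^{−α} E(ρ)^β` with
`c > 0`, `β > 1`, `α < 1` can only live on a bounded range of `ρ`, quantitatively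
`(β−1)c/(1−α) · (R^{1−α} − ρ₀^{1−α}) ≤ E(ρ₀)^{1−β}` on every interval `[ρ₀, R]` of existence
(separation of variables: `ρ ↦ E(ρ)^{1−β} + (β−1)c ρ^{1−α}/(1−α)` is non-increasing). The case
`α = 0`, `β = 3` is the explicit blow-up time of `dX/dt = cX³` in Robinson–Rodrigo–Sadowski 2016,
§6.2 (6.8) (there used from above for the enstrophy; here from below). This is the real-variable
closure of «integration against a bounded left-hand side produces a contradiction» arguments in
claimed Liouville/regularity proofs adjudicated by the cell `ns-claims` (D-0090; row C178
`Nahiru2026`, Prop 8.1 ⇒ Thm 9.1, p.13–14: `α = (12−5p)/(3(3−p)) < 1 < β = (6−p)/(3(3−p))`), kept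
separate from the analysis that is supposed to produce the law.

* `rpow_sub_rpow_le_of_deriv_ge` — the quantitative finite-range bound on `[ρ₀, R]`;
* `not_superlinearLowerBound_on_Ici` — no positive differentiable `E` satisfies the law on all of
  `[ρ₀, ∞)` (`ρ₀ > 0`) — the packaging used by «`E` non-decreasing and `E → ∞` is impossible»
  arguments.

[cite: RobinsonRodrigoSadowskiCUP2016, §6.2 (6.8) p.134 (blow-up time of dX/dt = cX³); separable form with weight ρ^{−α}]

WHAT THIS IS NOT: not a claim about NS regularity or blow-up; not a claim about any author beyond the
typed locator.
-/

noncomputable section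

open Set Filter Topology Real

namespace Literature.Analysis.ODE

/-- **Finite range of `E' ≥ cρ^{−α}E^β`.** Let `0 < ρ₀ ≤ R`, `c > 0`, `α < 1 < β`, and let `E` be
positive on `[ρ₀, R]` with derivatives `E'` within `[ρ₀, R]` satisfying `c ρ^{−α} E(ρ)^β ≤ E'(ρ)`
there. Then `(β − 1) c / (1 − α) · (R^{1−α} − ρ₀^{1−α}) ≤ E(ρ₀)^{1−β}` (the function
`E^{1−β} + (β−1)c ρ^{1−α}/(1−α)` is non-increasing and `E(R)^{1−β} > 0`). The case `α = 0`, `β = 3`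
is the blow-up time `T = 1/(2cX₀²)` of `X' = cX³` (Robinson–Rodrigo–Sadowski 2016, (6.8)).
[cite: RobinsonRodrigoSadowskiCUP2016, §6.2 (6.8) p.134] -/
theorem rpow_sub_rpow_le_of_deriv_ge {E E' : ℝ → ℝ} {c α β ρ₀ R : ℝ} (hc : 0 < c) (hα : α < 1)
    (hβ : 1 < β) (hρ₀ : 0 < ρ₀) (hR : ρ₀ ≤ R) (hpos : ∀ ρ ∈ Icc ρ₀ R, 0 < E ρ)
    (hd : ∀ ρ ∈ Icc ρ₀ R, HasDerivWithinAt E (E' ρ) (Icc ρ₀ R) ρ)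
    (hlaw : ∀ ρ ∈ Icc ρ₀ R, c * ρ ^ (-α) * E ρ ^ β ≤ E' ρ) :
    (β - 1) * c / (1 - α) * (R ^ (1 - α) - ρ₀ ^ (1 - α)) ≤ E ρ₀ ^ (1 - β) := by
  have h1α : 0 < 1 - α := by linarith
  have hβ1 : 0 < β - 1 := by linarith
  set k : ℝ := (β - 1) * c / (1 - α) with hk
  -- the Lyapunov function `H = E^{1−β} + k ρ^{1−α}` and its derivative within `[ρ₀, R]`
  set H : ℝ → ℝ := fun ρ => E ρ ^ (1 - β) + k * ρ ^ (1 - α) with hH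
  have hHd : ∀ ρ ∈ Icc ρ₀ R, HasDerivWithinAt H
      ((1 - β) * E ρ ^ (1 - β - 1) * E' ρ + k * ((1 - α) * ρ ^ (1 - α - 1))) (Icc ρ₀ R) ρ := by
    intro ρ hρ
    have hρ0 : 0 < ρ := hρ₀.trans_le hρ.1
    have h1 : HasDerivWithinAt (fun r => E r ^ (1 - β)) ((1 - β) * E ρ ^ (1 - β - 1) * E' ρ)
        (Icc ρ₀ R) ρ := by
      have := (hd ρ hρ).rpow_const (p := 1 - β) (Or.inl (hpos ρ hρ).ne')
      convert this using 1; ring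
    have h2 : HasDerivWithinAt (fun r : ℝ => r ^ (1 - α)) ((1 - α) * ρ ^ (1 - α - 1)) (Icc ρ₀ R) ρ := by
      have := (hasDerivWithinAt_id ρ (Icc ρ₀ R)).rpow_const (p := 1 - α) (Or.inl hρ0.ne')
      simpa using this
    exact h1.add (h2.const_mul k)
  have hHle : ∀ ρ ∈ Icc ρ₀ R,
      (1 - β) * E ρ ^ (1 - β - 1) * E' ρ + k * ((1 - α) * ρ ^ (1 - α - 1)) ≤ 0 := by
    intro ρ hρ
    have hρ0 : 0 < ρ := hρ₀.trans_le hρ.1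
    have hE := hpos ρ hρ
    have hEb : 0 < E ρ ^ (1 - β - 1) := rpow_pos_of_pos hE _
    -- `E^{−β} E' ≥ c ρ^{−α}`
    have hlaw' : c * ρ ^ (-α) ≤ E ρ ^ (1 - β - 1) * E' ρ := by
      have h1 : E ρ ^ (1 - β - 1) * (c * ρ ^ (-α) * E ρ ^ β) ≤ E ρ ^ (1 - β - 1) * E' ρ :=
        mul_le_mul_of_nonneg_left (hlaw ρ hρ) hEb.le
      have h2 : E ρ ^ (1 - β - 1) * (c * ρ ^ (-α) * E ρ ^ β) = c * ρ ^ (-α) := by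
        have h3 : E ρ ^ (1 - β - 1) * E ρ ^ β = 1 := by
          rw [← rpow_add hE]; norm_num
        calc E ρ ^ (1 - β - 1) * (c * ρ ^ (-α) * E ρ ^ β)
            = c * ρ ^ (-α) * (E ρ ^ (1 - β - 1) * E ρ ^ β) := by ring
          _ = c * ρ ^ (-α) := by rw [h3, mul_one]
      linarith
    have hkid : k * ((1 - α) * ρ ^ (1 - α - 1)) = (β - 1) * c * ρ ^ (-α) := by
      rw [hk, show (1 - α - 1 : ℝ) = -α by ring]
      field_simp
    rw [hkid]
    have : (1 - β) * E ρ ^ (1 - β - 1) * E' ρ = -(β - 1) * (E ρ ^ (1 - β - 1) * E' ρ) := by ring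
    rw [this]
    nlinarith
  -- `H` is non-increasing on `[ρ₀, R]`
  have hHc : ContinuousOn H (Icc ρ₀ R) := fun ρ hρ => (hHd ρ hρ).continuousWithinAt
  have hanti : AntitoneOn H (Icc ρ₀ R) := by
    refine antitoneOn_of_hasDerivWithinAt_nonpos (convex_Icc ρ₀ R) hHc
      (f' := fun ρ => (1 - β) * E ρ ^ (1 - β - 1) * E' ρ + k * ((1 - α) * ρ ^ (1 - α - 1)))
      (fun ρ hρ => ?_) fun ρ hρ => ?_
    · rw [interior_Icc] at hρ
      exact ((hHd ρ (Ioo_subset_Icc_self hρ)).mono interior_subset)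
    · rw [interior_Icc] at hρ
      exact hHle ρ (Ioo_subset_Icc_self hρ)
  have hmain := hanti (left_mem_Icc.2 hR) (right_mem_Icc.2 hR) hR
  -- `H R ≤ H ρ₀` with `E(R)^{1−β} > 0`
  have hER : 0 < E R ^ (1 - β) := rpow_pos_of_pos (hpos R (right_mem_Icc.2 hR)) _
  simp only [hH] at hmain
  have : k * R ^ (1 - α) - k * ρ₀ ^ (1 - α) ≤ E ρ₀ ^ (1 - β) := by linarith
  calc k * (R ^ (1 - α) - ρ₀ ^ (1 - α)) = k * R ^ (1 - α) - k * ρ₀ ^ (1 - α) := by ring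
    _ ≤ E ρ₀ ^ (1 - β) := this

/-- **No positive solution of `E' ≥ cρ^{−α}E^β` (`c > 0`, `α < 1 < β`) exists on a whole half-line
`[ρ₀, ∞)`, `ρ₀ > 0`**: the finite-range bound `rpow_sub_rpow_le_of_deriv_ge` fails for large `R`
since `R^{1−α} → ∞`. (Separable superlinear blow-up; Robinson–Rodrigo–Sadowski 2016, §6.2 (6.8) for
`X' = cX³`.) [cite: RobinsonRodrigoSadowskiCUP2016, §6.2 (6.8) p.134] -/
theorem not_superlinearLowerBound_on_Ici {E E' : ℝ → ℝ} {c α β ρ₀ : ℝ} (hc : 0 < c) (hα : α < 1)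
    (hβ : 1 < β) (hρ₀ : 0 < ρ₀) (hpos : ∀ ρ, ρ₀ ≤ ρ → 0 < E ρ)
    (hd : ∀ R, ρ₀ ≤ R → ∀ ρ ∈ Icc ρ₀ R, HasDerivWithinAt E (E' ρ) (Icc ρ₀ R) ρ)
    (hlaw : ∀ ρ, ρ₀ ≤ ρ → c * ρ ^ (-α) * E ρ ^ β ≤ E' ρ) : False := by
  have h1α : 0 < 1 - α := by linarith
  have hβ1 : 0 < β - 1 := by linarith
  set k : ℝ := (β - 1) * c / (1 - α) with hk
  have hk0 : 0 < k := by positivity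
  -- choose `R` with `k (R^{1−α} − ρ₀^{1−α}) > E(ρ₀)^{1−β}`
  set B : ℝ := E ρ₀ ^ (1 - β) / k + ρ₀ ^ (1 - α) + 1 with hB
  have hB0 : 0 < B := by
    have : 0 < E ρ₀ ^ (1 - β) / k := div_pos (rpow_pos_of_pos (hpos ρ₀ le_rfl) _) hk0
    have : 0 ≤ ρ₀ ^ (1 - α) := rpow_nonneg hρ₀.le _
    linarith
  set R : ℝ := max ρ₀ (B ^ (1 / (1 - α))) with hRdef
  have hR : ρ₀ ≤ R := le_max_left _ _
  have hRpow : B ≤ R ^ (1 - α) := by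
    have h1 : (B ^ (1 / (1 - α))) ^ (1 - α) = B := by
      rw [← rpow_mul hB0.le, one_div_mul_cancel h1α.ne', rpow_one]
    calc B = (B ^ (1 / (1 - α))) ^ (1 - α) := h1.symm
      _ ≤ R ^ (1 - α) := rpow_le_rpow (rpow_nonneg hB0.le _) (le_max_right _ _) h1α.le
  have hfin := rpow_sub_rpow_le_of_deriv_ge hc hα hβ hρ₀ hR (fun ρ hρ => hpos ρ hρ.1) (hd R hR)
    fun ρ hρ => hlaw ρ hρ.1
  -- contradiction
  have h2 : k * (R ^ (1 - α) - ρ₀ ^ (1 - α)) ≥ k * (B - ρ₀ ^ (1 - α)) :=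
    mul_le_mul_of_nonneg_left (by linarith) hk0.le
  have h3 : k * (B - ρ₀ ^ (1 - α)) = E ρ₀ ^ (1 - β) + k := by
    rw [hB]; field_simp; ring
  have : k * (R ^ (1 - α) - ρ₀ ^ (1 - α)) ≤ E ρ₀ ^ (1 - β) := hfin
  linarith

end Literature.Analysis.ODE
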